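import Literature.AnabelianGeometry.SemiGraphs.PSCSmoothCurveGenuineRestrict
import Literature.AnabelianGeometry.SemiGraphs.PSCRankStatementsSmoothProper
import Literature.AnabelianGeometry.SemiGraphs.PSCCoveringDatumTransport
import Literature.AnabelianGeometry.SemiGraphs.ProSigmaCompletionQuotientTransfer
import Literature.AnabelianGeometry.SemiGraphs.ProSigmaSubquotients
import Literature.GroupTheory.CombinatorialGroupTheory.PuncturedSurfaceGroupElevationQuotients
import Literature.GroupTheory.CombinatorialGroupTheory.PuncturedSurfaceGroupCuspQuotients
import HarnessLib

/-!
# [CombGC] Rmk. 1.1.3 / 1.3.1 rank statements at genuine smooth-CURVE data: three of four, and `M^cusp ≠ 0`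

Mochizuki, *A combinatorial version of the Grothendieck conjecture* [CombGC], Tohoku Math. J. **59**
(2007), Rmk. 1.1.3 p. 8 (rank of `Π^grph`), Rmk. 1.3.1 p. 10: "if `G` is sturdy … the ranks of
`M^edge_G/M^cusp_G`, `M_G/M^vert_G` coincide"; "if `G` has cusps, then the rank of `M^cusp_G` is equal to
`r(G) − 1`"; "`G` is noncuspidal if and only if `M^cusp_{G'} = 0` for every finite étale covering
`G' → G`" — typed by abc-iut-w4-d052 as `AbelianizedGrphRank`, `DualityRankEq`, `CuspRank`,
`NoncuspidalIffCuspFilTrivial`, bundled into `RankStatementsHold Ω` (F-3098).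
[cite: MochizukiCombGC2007, Rmk 1.3.1 p.10] [cite: MochizukiCombGC2007, Rmk 1.1.3 p.8]

PROOF-ONLY file (abc-iut cell, layer L3, [CombGC] non-vacuity programme; seat abc-iut-w5-d195 gen 7,
brick «SC-GENUINE-COVERING-CLOSED», part I; the smooth-PROPER shape is abc-iut-w5-d183's
`PSCRankStatementsSmoothProper.lean`).  At a GENUINE smooth-curve datum `G` (profinite `Π`, one vertex
`Π_v = Π`, no nodes, `ι : Γ_{g,r} → Π` a pro-`Σ` completion of a hyperbolic punctured surface group, cusp
groups conjugates of `closure ι⟨c_j⟩`):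

* `edgeFil_eq_cuspFil_of_isEmpty` — with no nodes `M^edge_{G_U} = M^cusp_{G_U}`; hence
  `dualityRankEq_of_isEmpty` (Rmk. 1.3.1, first claim: both ranks are `0`, as `M_{G_U} = M^vert_{G_U}`
  at one-vertex data) — and Rmk. 1.1.3 is abc-iut-w5-d183's `abelianizedGrphRank_of_smoothProper`;
* `cuspFil_top_ne_of_two_cusps` — **`M^cusp_G ≠ 0` for a smooth curve with two cusps**: the character
  `Γ_{g,r} → ℤ/ℓ`, `c_{j₁} ↦ 1`, `c_{j₂} ↦ −1` (`PuncturedSurfaceGroup.exists_hom_pair`, `ℓ ∈ Σ`)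
  extends to an open `W ⊴ Π` containing `closure[Π,Π]` but not the cusp element `ι(c_{j₁}) ∈ M^cusp`;
* `exists_isOpen_cuspFil_ne_of_smoothCurveGenuine` — with ONE cusp (`g ≥ 1`) the same holds at the
  `ℤ/ℓ`-level `V` of `a₁ ↦ 1` (`exists_hom_a_surjective`), an unramified covering with `ℓ ≥ 2` cusps, a
  genuine smooth curve by `restrict_smoothCurveGenuine`, transported back along
  `map_subtype_cuspFil` (abc-iut-w5-d226);
* `noncuspidalIffCuspFilTrivial_of_smoothCurveGenuine` — **Rmk. 1.3.1, third claim, HOLDS at genuine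
  smooth-curve data** (both directions genuine: `r = 0` ⇒ every `M^cusp_{G_U} = 0`; `r ≥ 1` ⇒ some
  `M^cusp_{G_U} ≠ 0`).

HONEST SCOPE: the second claim `CuspRank` (rank EXACTLY `r(G_U) − 1`: the closure of the cusp sublattice
`ℤ^{r−1} ⊂ Γ_{g,r}^{ab}` inside `Π^{ab}`) is NOT proved here; it is the one conjunct of
`RankStatementsHold` still open at smooth-curve data.  0 definitions; nothing here takes a side on
[IUTchIII] Cor. 3.12.
-/

noncomputable section

namespace Literature.AnabelianGeometry.SemiGraphs

namespace PSCDatum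

open scoped Pointwise
open Multiplicative
open Literature.GroupTheory.CombinatorialGroupTheory
open Literature.GroupTheory.CombinatorialGroupTheory.PuncturedSurfaceGroup (c cuspInertia IsHyperbolicType
  exists_hom_pair exists_hom_a_surjective index_ker_dvd_card)
open Literature.AnabelianGeometry.Anabelioids (IsSigmaInteger)
open SemiGraphOfAnabelioids (IsProSigmaCompletion)
open SemiGraphOfAnabelioids.IsProSigmaCompletion (normal_of_comap_normal isSigmaInteger_prime_pow
  index_comap_of_isOpen)

universe u

variable {P : Type u} [Group P] [TopologicalSpace P]

/-! ### No nodes: `M^edge = M^cusp`; Rmk. 1.3.1 first claim -/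

section NoNodes

variable [IsTopologicalGroup P] (G : PSCDatum P) [IsEmpty G.graph.N]

/-- With no nodes the edge-like subgroups are the cuspidal ones, so `M^edge_{G_U} = M^cusp_{G_U}`.
[cite: MochizukiCombGC2007, Def 1.1(ii) p.7] -/
theorem edgeFil_eq_cuspFil_of_isEmpty (U : Subgroup P) : G.edgeFil U = G.cuspFil U := by
  unfold edgeFil cuspFil
  congr 1
  refine le_antisymm (sup_le_sup_left (iSup_le fun A => ?_) _) (sup_le_sup_left (iSup_le fun A => ?_) _)
  · obtain ⟨B, hB, hAB⟩ := A.2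
    have hBc : G.IsCuspidal B := hB.resolve_left (G.not_isNodal_of_isEmpty B)
    exact le_iSup_of_le (ι := {A : Subgroup P // G.IsCuspidalIn U A}) ⟨A.1, B, hBc, hAB⟩ le_rfl
  · obtain ⟨B, hB, hAB⟩ := A.2
    exact le_iSup_of_le (ι := {A : Subgroup P // G.IsEdgeLikeIn U A}) ⟨A.1, B, Or.inr hB, hAB⟩ le_rfl

/-- **[CombGC] Rmk. 1.3.1, first claim, at one-vertex node-free data with `Π_v = Π`** (any cusps): at
every open level `M_{G_U}/M^vert_{G_U} = 0` (`vertFil U = U`) and `M^edge_{G_U}/M^cusp_{G_U} = 0`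
(`edgeFil U = cuspFil U`) — pro-`Σ` completions of the same `ℤ^0`. [cite: MochizukiCombGC2007, Rmk 1.3.1 p.10] -/
theorem dualityRankEq_of_isEmpty (hV : ∀ v, G.vertGp v = ⊤) (v₀ : G.graph.V) : G.DualityRankEq := by
  intro _ U hU _ _
  have htop : (G.vertFil U).subgroupOf U = ⊤ := by
    rw [G.vertFil_eq_self_of_isOpen hV v₀ hU, Subgroup.subgroupOf_self]
  haveI : Subsingleton (U ⧸ (G.vertFil U).subgroupOf U) := by
    rw [htop]
    exact QuotientGroup.subsingleton_quotient_top
  have htop' : (G.cuspFil U).subgroupOf (G.edgeFil U) = ⊤ := by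
    rw [G.edgeFil_eq_cuspFil_of_isEmpty, Subgroup.subgroupOf_self]
  haveI : Subsingleton (G.edgeFil U ⧸ (G.cuspFil U).subgroupOf (G.edgeFil U)) := by
    rw [htop']
    exact QuotientGroup.subsingleton_quotient_top
  exact ⟨0, 1, 1, isProSigmaCompletion_of_subsingleton G.Sigma _,
    isProSigmaCompletion_of_subsingleton G.Sigma _⟩

end NoNodes

/-! ### `M^cusp_G ≠ 0` for a smooth curve with two cusps -/

section TwoCusps

variable [IsTopologicalGroup P] (G : PSCDatum P) {g r : ℕ}

/-- **`M^cusp_G ≠ 0` at a genuine smooth curve with two distinct cusps**: for `G` with cusp groups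
conjugates of `closure ι⟨c_j⟩` (`ι : Γ_{g,r} → Π` a pro-`Σ` completion, `Σ = G.Sigma`) and cusps
`c₁ ≠ c₂`, `M^cusp_G ⊋ 0`, i.e. `cuspFil Π ≠ closure[Π,Π]`: the cusp character `c_{e c₁} ↦ 1`,
`c_{e c₂} ↦ −1` to `ℤ/ℓ` (`ℓ ∈ Σ`) is the trace of an open `W ⊴ Π` with `closure[Π,Π] ⊆ W ∌ ι(c_{e c₁})`,
while `ι(c_{e c₁}) ∈ cuspFil Π`. [cite: MochizukiCombGC2007, Rmk 1.3.1 p.10] -/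
theorem cuspFil_top_ne_of_two_cusps (ι : PuncturedSurfaceGroup g r →* P)
    (hι : IsProSigmaCompletion G.Sigma ι) (e : G.graph.C ≃ Fin r)
    (hC : ∀ c, ∃ δ : ConjAct P,
      G.cuspGp c = δ • ((cuspInertia (g := g) (e c)).map ι).topologicalClosure)
    {c₁ c₂ : G.graph.C} (hc : c₁ ≠ c₂) :
    G.cuspFil ⊤ ≠ (⁅(⊤ : Subgroup P), (⊤ : Subgroup P)⁆ : Subgroup P).topologicalClosure := by
  classical
  obtain ⟨ℓ, hℓS⟩ := G.sigma_nonempty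
  have hℓ : ℓ.Prime := G.sigma_prime ℓ hℓS
  haveI : Fact ℓ.Prime := ⟨hℓ⟩
  have hj : e c₁ ≠ e c₂ := fun h' => hc (e.injective h')
  obtain ⟨χ, hχ₁, -, -⟩ := exists_hom_pair (g := g) (e c₁) (e c₂) hj ℓ
  -- the open level `W ⊴ Π` with `ι⁻¹(W) = ker χ`
  have hNS : IsSigmaInteger G.Sigma χ.ker.index := by
    refine (isSigmaInteger_prime_pow hℓ hℓS 1).of_dvd ?_
    rw [pow_one]
    exact (index_ker_dvd_card χ).trans (by rw [Nat.card_eq_fintype_card, Fintype.card_multiplicative,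
      ZMod.card])
  obtain ⟨W, hWo, hWc⟩ := hι.comap_surj χ.ker inferInstance hNS
  -- `closure[Π,Π] ≤ W`
  have hcomm : (⁅(⊤ : Subgroup P), (⊤ : Subgroup P)⁆ : Subgroup P).topologicalClosure ≤ W := by
    rw [← commutator_def, ← IsProSigmaCompletion.topologicalClosure_map_commutator_eq hι.dense]
    refine Subgroup.topologicalClosure_minimal _ ?_ (W.isClosed_of_isOpen hWo)
    rw [Subgroup.map_le_iff_le_comap, hWc]
    exact Abelianization.commutator_subset_ker χ
  -- `ι(c_{e c₁}) ∉ W`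
  have hnot : ι (c (g := g) (e c₁)) ∉ W := by
    intro hmem
    have h1 : c (g := g) (e c₁) ∈ W.comap ι := hmem
    rw [hWc, MonoidHom.mem_ker, hχ₁, ofAdd_eq_one] at h1
    exact one_ne_zero h1
  -- `ι(c_{e c₁}) ∈ cuspFil Π`
  have hin : ι (c (g := g) (e c₁)) ∈ G.cuspFil ⊤ := by
    obtain ⟨δ, hδ⟩ := hC c₁
    have hA : G.IsCuspidalIn ⊤ (δ⁻¹ • G.cuspGp c₁) :=
      ⟨δ⁻¹ • G.cuspGp c₁, ⟨c₁, δ⁻¹, rfl⟩, (top_inf_eq _).symm⟩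
    have hx : ι (c (g := g) (e c₁)) ∈ δ⁻¹ • G.cuspGp c₁ := by
      rw [hδ, inv_smul_smul]
      exact Subgroup.le_topologicalClosure _ (Subgroup.mem_map_of_mem ι (Subgroup.mem_zpowers _))
    unfold cuspFil
    exact Subgroup.le_topologicalClosure _ (Subgroup.mem_sup_right
      (le_iSup (fun A : {A : Subgroup P // G.IsCuspidalIn ⊤ A} => (A : Subgroup P)) ⟨_, hA⟩ hx))
  intro heq
  rw [heq] at hin
  exact hnot (hcomm hin)

end TwoCusps

/-! ### One cusp: pass to an unramified `ℤ/ℓ`-level with `ℓ` cusps -/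

section OneCusp

variable [IsTopologicalGroup P] [CompactSpace P] [TotallyDisconnectedSpace P] (G : PSCDatum P)
  [IsEmpty G.graph.N] {g r : ℕ}

/-- **A genuine smooth curve WITH cusps has a level with `M^cusp ≠ 0`**: `∃ U` open with
`cuspFil U ≠ closure[U,U]`.  With two cusps take `U = Π` (`cuspFil_top_ne_of_two_cusps`); with one cusp
(`g ≥ 1`) take the `ℤ/ℓ`-level `V` of `a₁ ↦ 1` — unramified at the cusp, so `G_V` is a genuine smooth
curve (`restrict_smoothCurveGenuine`) with `r(G_V) = ℓ ≥ 2` cusps — and transport `M^cusp_{G_V} ≠ 0` back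
along `map_subtype_cuspFil`. [cite: MochizukiCombGC2007, Rmk 1.3.1 p.10] -/
theorem exists_isOpen_cuspFil_ne_of_smoothCurveGenuine (hV : ∀ v, G.vertGp v = ⊤) (v₀ : G.graph.V)
    (hv : ∀ w, w = v₀) (h : IsHyperbolicType g r) (hr : 0 < r) (ι : PuncturedSurfaceGroup g r →* P)
    (hι : IsProSigmaCompletion G.Sigma ι) (e : G.graph.C ≃ Fin r)
    (hC : ∀ c, ∃ δ : ConjAct P,
      G.cuspGp c = δ • ((cuspInertia (g := g) (e c)).map ι).topologicalClosure)
    (hgen : ∀ v, G.genus v = g) :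
    ∃ U : Subgroup P, IsOpen (U : Set P) ∧ G.cuspFil U ≠ (⁅U, U⁆ : Subgroup P).topologicalClosure := by
  classical
  by_cases hr2 : 2 ≤ r
  · -- two cusps: the trivial level
    refine ⟨⊤, by rw [Subgroup.coe_top]; exact isOpen_univ, ?_⟩
    have hne : e.symm ⟨0, by omega⟩ ≠ e.symm ⟨1, by omega⟩ := fun h' => by
      have := e.symm.injective h'
      simp [Fin.ext_iff] at this
    exact G.cuspFil_top_ne_of_two_cusps ι hι e hC hne
  · -- one cusp: `r = 1`, `g ≥ 1`
    have hr1 : r = 1 := by omega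
    have hg : 0 < g := by unfold IsHyperbolicType at h; omega
    obtain ⟨ℓ, hℓS⟩ := G.sigma_nonempty
    have hℓ : ℓ.Prime := G.sigma_prime ℓ hℓS
    haveI : NeZero ℓ := ⟨hℓ.ne_zero⟩
    obtain ⟨χ, hχs, hχc⟩ := exists_hom_a_surjective (g := g) (r := r) hg ℓ
    have hidx : χ.ker.index = ℓ := by
      rw [Subgroup.index_ker, MonoidHom.range_eq_top.mpr hχs, Subgroup.card_top, Nat.card_eq_fintype_card,
        Fintype.card_multiplicative, ZMod.card]
    have hNS : IsSigmaInteger G.Sigma χ.ker.index := by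
      rw [hidx]; exact (isSigmaInteger_prime_pow hℓ hℓS 1).of_dvd (by rw [pow_one])
    obtain ⟨V, hVo, hVc⟩ := hι.comap_surj χ.ker inferInstance hNS
    haveI hVn : V.Normal := normal_of_comap_normal hι V hVo (by rw [hVc]; infer_instance)
    haveI : V.FiniteIndex := IsProSigma.finiteIndex_of_isOpen G.proSigma V hVo
    -- every cusp group lies in `V` (the covering is unramified at the cusp)
    have hcuspV : ∀ c₀, G.cuspGp c₀ ≤ V := fun c₀ => by
      obtain ⟨δ, hδ⟩ := hC c₀
      rw [hδ, ← hVn.conjAct δ, Subgroup.pointwise_smul_le_pointwise_smul_iff]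
      refine Subgroup.topologicalClosure_minimal _ ?_ (V.isClosed_of_isOpen hVo)
      rw [Subgroup.map_le_iff_le_comap, hVc]
      intro x hx
      obtain ⟨k, rfl⟩ := Subgroup.mem_zpowers_iff.mp hx
      rw [MonoidHom.mem_ker, map_zpow, hχc, one_zpow]
    -- `r(G_V) = [Π : V] = ℓ ≥ 2`
    have hcount : G.cuspCount V = V.index := by
      rw [G.cuspCount_eq_sum_index V, Finset.sum_congr rfl fun c₀ _ =>
        congrArg Subgroup.index (sup_of_le_left (hcuspV c₀)), Finset.sum_const, Finset.card_univ,
        smul_eq_mul, Fintype.card_congr e, Fintype.card_fin, hr1, one_mul]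
    have hVidx : V.index = ℓ := by rw [← index_comap_of_isOpen hι V hVo, hVc, hidx]
    -- the level datum `G_V`: a genuine smooth curve with `ℓ ≥ 2` cusps
    haveI : CompactSpace V := isCompact_iff_compactSpace.mp (V.isClosed_of_isOpen hVo).isCompact
    obtain ⟨hN', -, -, g', r', ι', e', -, hι', -, -, hC'⟩ :=
      G.restrict_smoothCurveGenuine V hVo hV v₀ hv h ι hι e hC hgen
    haveI := hN'
    have hr' : r' = ℓ := by
      have h1 := Fintype.card_congr e'
      rw [Fintype.card_fin] at h1
      rw [← h1]
      change (G.restrict V hVo).graph.r = ℓ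
      rw [G.restrict_graph_r V hVo, hcount, hVidx]
    have hne : e'.symm ⟨0, by rw [hr']; exact hℓ.pos⟩ ≠ e'.symm ⟨1, by rw [hr']; exact hℓ.one_lt⟩ :=
      fun h' => by
        have := e'.symm.injective h'
        simp [Fin.ext_iff] at this
    have hneV := (G.restrict V hVo).cuspFil_top_ne_of_two_cusps ι' hι' e' hC' hne
    refine ⟨V, hVo, fun heq => hneV ?_⟩
    -- transport along `V ↪ Π`
    apply Subgroup.map_injective V.subtype_injective
    rw [G.map_subtype_cuspFil hVo ⊤, ← MonoidHom.range_eq_map, Subgroup.range_subtype, heq,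
      ← topologicalClosure_map_of_isClosedEmbedding V.subtype
        (V.isClosed_of_isOpen hVo).isClosedEmbedding_subtypeVal,
      Subgroup.map_commutator, ← MonoidHom.range_eq_map, Subgroup.range_subtype]

/-- **[CombGC] Rmk. 1.3.1, third claim, HOLDS at genuine smooth-curve data**: `G` is noncuspidal iff
`M^cusp_{G_U} = 0` at every open level — `r = 0` gives `cuspFil U = closure[U,U]` everywhere (no cuspidal
subgroups), `r ≥ 1` gives a level with `M^cusp ≠ 0` (`exists_isOpen_cuspFil_ne_of_smoothCurveGenuine`).
[cite: MochizukiCombGC2007, Rmk 1.3.1 p.10] -/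
theorem noncuspidalIffCuspFilTrivial_of_smoothCurveGenuine (hV : ∀ v, G.vertGp v = ⊤) (v₀ : G.graph.V)
    (hv : ∀ w, w = v₀) (h : IsHyperbolicType g r) (ι : PuncturedSurfaceGroup g r →* P)
    (hι : IsProSigmaCompletion G.Sigma ι) (e : G.graph.C ≃ Fin r)
    (hC : ∀ c, ∃ δ : ConjAct P,
      G.cuspGp c = δ • ((cuspInertia (g := g) (e c)).map ι).topologicalClosure)
    (hgen : ∀ v, G.genus v = g) : G.NoncuspidalIffCuspFilTrivial := by
  have hr : G.graph.r = r := by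
    change Fintype.card G.graph.C = r
    rw [Fintype.card_congr e, Fintype.card_fin]
  constructor
  · intro h0 U _
    have hr0 : r = 0 := by rw [← hr]; exact h0
    haveI : IsEmpty G.graph.C := by
      rw [← Fintype.card_eq_zero_iff]
      change G.graph.r = 0
      exact h0
    exact G.cuspFil_eq_closure_commutator_of_isEmpty U
  · intro hall
    by_contra hne
    have hpos : 0 < r := by
      rw [← hr]
      exact Nat.pos_of_ne_zero hne
    obtain ⟨U, hU, hneq⟩ := G.exists_isOpen_cuspFil_ne_of_smoothCurveGenuine hV v₀ hv h hpos ι hι e hC hgen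
    exact hneq (hall U hU)

end OneCusp

end PSCDatum

end Literature.AnabelianGeometry.SemiGraphs

end
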